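import Literature.Probability.RandomPlanarGeometry.HexSAWBrickWallStripFugacityWidthOneSeries
import Literature.Probability.RandomPlanarGeometry.HexSAWBrickWallStripFugacityWidthOneExact
import Mathlib.Analysis.SpecificLimits.Normed
import Mathlib.Analysis.Complex.Polynomial.Basic
import Mathlib.Tactic
import HarnessLib

/-!
# The amplitude of the one-cell honeycomb strip with two equal attractive walls:
# `C_{1,N}(y,y) ∼ A(y) · μ_1(y,y)^N` for every fugacity `y > 0`, with `A(y)` explicit

Topic `Literature/Probability/RandomPlanarGeometry` (continues `HexSAWBrickWallStripFugacityWidthOneSeries.lean`: the rational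
two-fugacity walk series `Σ_N C_{1,N}(y,z) x^N = P(x;y,z)/([(1−yx²)(1−zx²) − yzx⁶](1−yzx⁴)²)` of the width-one row strip
`S_1 = ℤ × {0,1}` of the brick-wall (= honeycomb) lattice with site fugacities `y, z` on the two rows, `C_{1,N}(y,z) =
HexBW.stripZ₂ 1 N y z` — in particular `stripZ₂_one_self_series` at `z = y`, where the denominator factors as
`(1 − yx² − yx³)(1 − yx² + yx³)(1 − y²x⁴)²`; and `HexSAWBrickWallStripFugacityWidthOneExact.lean`: the growth rate
`μ_1(y,y) = stripMuY₂ 1 y y` is the unique positive root of `μ³ = yμ + y` (`stripMuY₂_one_self_pow_three_eq`), `y < μ_1(y,y)²`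
(`lt_stripMuY₂_one_self_sq`), `0 < μ_1(y,y)` (`stripMuY₂_pos`)).

For walks confined to a one-dimensional lattice the susceptibility exponent is `γ = 1` — `c_N ∼ const · μ^N` — by transfer
matrices / Perron–Frobenius (Klein 1980, Alm–Janson 1990, reported by Madras–Slade §8.5); the previous file
`HexSAWBrickWallStripWidthOneAmplitude.lean` made this explicit for the plain walk counts of `S_1` (`y = z = 1`).  Here the
amplitude is made EXPLICIT FOR THE WHOLE ONE-PARAMETER FAMILY of equal attractive walls `z = y > 0`:

  ★★★ `tendsto_stripZ₂_one_self_div_pow`: for every `y > 0`,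
      `C_{1,N}(y,y) / μ_1(y,y)^N → A(y) = [U₂(y) + U₁(y)·μ + U₀(y)·μ²] / ((1 + 4y)² (3μ² − y))`, `μ = μ_1(y,y)`,
      `U₀ = 4 + 92y + 196y² + 144y³`, `U₁ = 4 + 32y + 220y² + 336y³`, `U₂ = 24y + 72y² + 192y³`
      (at `y = 1`: `A(1) = (288 + 592μ + 436μ²)/(25(3μ² − 1))`, the plain-walk amplitude; at `y = 1/2`: `μ = 1`, `A = 64/5`);
  ★★ `stripZ₂_one_self_isEquivalent`: `C_{1,N}(y,y) ∼ A(y)·μ_1(y,y)^N` (`Asymptotics.IsEquivalent`, M–S (1.1.4) with `γ = 1`);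
  ★ `tendsto_stripZ₂_one_self_ratio`: `C_{1,N+1}(y,y)/C_{1,N}(y,y) → μ_1(y,y)`; `stripZ₂_one_self_amplitude_pos`.

## The argument (elementary; no transfer-matrix spectral theory, no partial fractions over `ℂ`)

(1) REDUCED NUMERATOR.  `P(x;y,y) = P̃(x,y)·(1 − yx² + yx³)` EXACTLY (a `ring` identity), `P̃ = (2+2y) + (2+8y)x + (10y+2y²)x²
+ (4y+6y²)x³ + (2y+4y²−4y³)x⁴ + (8y²−12y³)x⁵ − (8y³+4y⁴)x⁶ − (4y³+8y⁴)x⁷ + (2y⁵−2y⁴)x⁸ + (2y⁴+4y⁵)x⁹ + (2y⁶−2y⁵)x¹⁰ + 2y⁶x¹¹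
+ 2y⁵x¹²` (at `y = 1` this is the numerator `walkP` of `HexSAWBrickWallStripWidthOneSeries.lean`); cancelling the non-zero
factor in the integral domain `ℝ⟦X⟧`: `(Σ_N C_{1,N}(y,y) X^N)·(1 − yX² − yX³)(1 − y²X⁴)² = P̃`.
(2) PARTIAL FRACTIONS OVER `ℚ(y)` (found by exact linear algebra, verified here by `ring`):
`(1+4y)²·P̃ = E·(1−yX²−yX³)(1−y²X⁴)² + U·(1−y²X⁴)² + V·(1−yX²−yX³)` with `E = (2+14y+16y²−32y³) − (2+16y+32y²)X`,
`U = U₀ + U₁X + U₂X²`, `V` of degree `7` — the common denominator is the perfect square `(1+4y)²`, never zero.  Hence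
`(1+4y)²·Σ C_{1,N} X^N = E + U·(1−yX²−yX³)⁻¹ + V·((1−y²X⁴)²)⁻¹` (inverses by `PowerSeries.invOfUnit`).
(3) COEFFICIENTS.  `u_N := [X^N] U/(1−yX²−yX³)` obeys `u_{N+3} = y u_{N+1} + y u_N` with `u_0, u_1, u_2 = U₀, U₁, U₂ + yU₀`;
`e_N := [X^N] V/(1−y²X⁴)²` obeys `e_{N+8} = 2y² e_{N+4} − y⁴ e_N`; and `(1+4y)² C_{1,N}(y,y) = u_N + e_N` for `N ≥ 2`.
(4) ASYMPTOTICS, UNIFORMLY IN `y`.  ★ `tendsto_div_pow_of_cubic_rec`: for ANY real solution of `u_{n+3} = y u_{n+1} + y u_n`,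
`u_n/μⁿ → (u_2 + μu_1 + (μ²−y)u_0)/(3μ² − y)` (`3μ² − y = p′(μ)`).  Proof by COMPLEX DEFLATION: with `v_n = u_n/μⁿ` and
`κ = y/μ³ = 1/(1+μ) ∈ (0,1)`, `v_{n+2} + v_{n+1} + κv_n` is constant and the centred sequence obeys `w_{n+2} = −w_{n+1} − κw_n`;
both roots of `s² + s + κ` lie in the open unit disc (`norm_lt_one_of_sq_add_self_add_eq_zero`, an elementary Schur–Cohn
check), and `tendsto_zero_of_rec_two` deflates over `ℂ` (`g_n = w_{n+1} − σ₁w_n = σ₂ⁿ g_0`,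
`‖w_{n+1}‖ ≤ r^{n+1}‖w_0‖ + (n+1)rⁿ‖g_0‖`) — ONE proof for all `y > 0`, although the two minor roots of `t³ − yt − y` are complex
for `y < 27/4`, real for `y > 27/4` and collide at `y = 27/4`.  `tendsto_div_pow_zero_of_rec_eight`: `e_N/μ^N → 0` from the
explicit solution `e_{4k+c} = y^{2k}e_c + k y^{2k−2}(e_{c+4} − y²e_c)` and `y² < μ⁴`, assembled over the residues mod `4`.

Sources.  N. R. Beaton, M. Bousquet-Mélou, J. de Gier, H. Duminil-Copin, A. J. Guttmann, CMP 326 (2014), arXiv:1109.0358v5 §3.2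
(p. 10: the strips `S_T` with wall fugacities and the partition functions `C_{T,N}(y,z)`; p. 12: the strip series are rational);
N. Madras, G. Slade, *The Self-Avoiding Walk* (1993), §1.1 eq. (1.1.4) p. 5 (`c_N ∼ Aμ^N N^{γ−1}`, "A, D, μ, γ and ν are
dimension-dependent positive constants"), §8.2 p. 267, §8.5 Notes pp. 278–279 (`γ(R) = 1` for one-dimensional lattices: Klein
1980, Alm–Janson 1990); S. E. Alm, S. Janson, Commun. Statist. Stochastic Models 6 (1990) 169–212 (the general theorem; no
amplitude for this model is printed); R. P. Stanley, *Enumerative Combinatorics* 1 (2nd ed.), §4.1 Theorem 4.1.1 (iii).  The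
explicit amplitude `A(y)` is not in print; it is derived here from the tree's rational series.

## Statements (namespace `Literature.Probability.RandomPlanarGeometry.SAW.HexBW.WidthOneYZ`, all PROVED, standard axioms; no
new definition)

§B1 `norm_lt_one_of_sq_add_self_add_eq_zero`, `tendsto_zero_of_rec_two`, ★ `tendsto_div_pow_of_cubic_rec`.
§B2 `tendsto_div_pow_zero_of_rec_eight` (+ private `tendsto_zero_of_mod_four`).  §B3 private coefficient lemmas
(`coeff_rec_three`, `coeff_init_three`, `coeff_rec_eight`).  §B4 ★★★ `tendsto_stripZ₂_one_self_div_pow`,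
`stripZ₂_one_self_amplitude_pos`, ★★ `stripZ₂_one_self_isEquivalent`, ★ `tendsto_stripZ₂_one_self_ratio`.
-/

noncomputable section

open Filter Topology Asymptotics PowerSeries

namespace Literature.Probability.RandomPlanarGeometry.SAW.HexBW

namespace WidthOneYZ

section cubic

/-! ## §B1 Uniform Binet for `t³ = y t + y` (complex deflation) -/

/-- The roots of `σ² + σ + κ = 0` with `0 < κ < 1` lie in the open unit disc (Schur–Cohn for `s² + s + κ`).
[cite: Stanley2012EC1, §4.1 (Theorem 4.1.1 (iii): the growth of the coefficients is governed by the reciprocal roots)] -/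
theorem norm_lt_one_of_sq_add_self_add_eq_zero {κ : ℝ} (hκ0 : 0 < κ) (hκ1 : κ < 1) {σ : ℂ}
    (h : σ ^ 2 + σ + κ = 0) : ‖σ‖ < 1 := by
  by_contra hge
  rw [not_lt] at hge
  set a := σ.re with ha
  set b := σ.im with hb
  have hre : a * a - b * b + a + κ = 0 := by
    have := congrArg Complex.re h
    simpa [sq, Complex.mul_re, Complex.add_re] using this
  have him : a * b + b * a + b = 0 := by
    have := congrArg Complex.im h
    simpa [sq, Complex.mul_im, Complex.add_im] using this
  -- `κ = ‖σ‖ · ‖σ + 1‖ ≥ ‖σ + 1‖`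
  have hprod : (κ : ℝ) = ‖σ‖ * ‖σ + 1‖ := by
    have h1 : (κ : ℂ) = -(σ * (σ + 1)) := by linear_combination h
    have h2 : ‖(κ : ℂ)‖ = ‖σ‖ * ‖σ + 1‖ := by rw [h1, norm_neg, norm_mul]
    rwa [Complex.norm_real, Real.norm_eq_abs, abs_of_pos hκ0] at h2
  have hn1 : ‖σ + 1‖ ^ 2 = (a + 1) * (a + 1) + b * b := by
    rw [Complex.sq_norm, Complex.normSq_apply]; simp [ha, hb]
  have h1 : 1 ≤ a * a + b * b := by
    rw [← Complex.normSq_apply, ← Complex.sq_norm]; nlinarith [norm_nonneg σ]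
  have h2 : (a + 1) * (a + 1) + b * b < 1 := by
    have h0 : 0 ≤ ‖σ + 1‖ := norm_nonneg _
    nlinarith
  have h3 : 2 * a + 1 < 0 := by nlinarith
  have hb0 : b = 0 := by
    have : b * (2 * a + 1) = 0 := by linear_combination him
    rcases mul_eq_zero.1 this with h | h
    · exact h
    · exact absurd h (ne_of_lt h3)
  rw [hb0] at hre h1
  nlinarith

/-- Every real solution of `w_{n+2} = −w_{n+1} − κ w_n` with `0 < κ < 1` tends to `0`: both roots of `s² + s + κ` lie in the
open unit disc; the proof deflates over `ℂ` (no case distinction at the double root `κ = 1/4`): with roots `σ₁, σ₂`,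
`g_n := w_{n+1} − σ₁ w_n = σ₂ⁿ g_0` and `‖w_{n+1}‖ ≤ r^{n+1}‖w_0‖ + (n+1) rⁿ ‖g_0‖`, `r = max ‖σ_i‖ < 1`.
[cite: Stanley2012EC1, §4.1 (Theorem 4.1.1 (iii))] -/
theorem tendsto_zero_of_rec_two {κ : ℝ} (hκ0 : 0 < κ) (hκ1 : κ < 1) {w : ℕ → ℝ}
    (hw : ∀ n, w (n + 2) = -w (n + 1) - κ * w n) : Tendsto w atTop (𝓝 0) := by
  obtain ⟨c, hc⟩ := IsAlgClosed.exists_pow_nat_eq (1 - 4 * (κ : ℂ)) (by norm_num : 0 < 2)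
  set σ₁ : ℂ := (-1 + c) / 2 with hσ₁
  set σ₂ : ℂ := (-1 - c) / 2 with hσ₂
  have hsum : σ₂ = -1 - σ₁ := by rw [hσ₁, hσ₂]; ring
  have hprod : σ₁ * σ₂ = κ := by
    rw [hσ₁, hσ₂]; linear_combination (-1 / 4 : ℂ) * hc
  have hq1 : σ₁ ^ 2 + σ₁ + κ = 0 := by rw [← hprod, hsum]; ring
  have hq2 : σ₂ ^ 2 + σ₂ + κ = 0 := by rw [← hprod, hsum]; ring
  have hn1 := norm_lt_one_of_sq_add_self_add_eq_zero hκ0 hκ1 hq1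
  have hn2 := norm_lt_one_of_sq_add_self_add_eq_zero hκ0 hκ1 hq2
  set r : ℝ := max ‖σ₁‖ ‖σ₂‖ with hr
  have hr0 : 0 ≤ r := le_max_of_le_left (norm_nonneg _)
  have hr1 : r < 1 := max_lt hn1 hn2
  set W : ℕ → ℂ := fun n => (w n : ℂ) with hW
  have hWrec : ∀ n, W (n + 2) = -W (n + 1) - (κ : ℂ) * W n := by
    intro n; simp only [hW, hw n]; push_cast; ring
  set g : ℕ → ℂ := fun n => W (n + 1) - σ₁ * W n with hg
  have hgrec : ∀ n, g (n + 1) = σ₂ * g n := by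
    intro n
    simp only [hg]
    rw [show n + 1 + 1 = n + 2 by omega, hWrec n, hsum]
    linear_combination (-(W n)) * hprod - (W n / 2) * hc
  have hgn : ∀ n, g n = σ₂ ^ n * g 0 := by
    intro n
    induction n with
    | zero => simp
    | succ n ih => rw [hgrec, ih]; ring
  have hbound : ∀ n : ℕ, ‖W (n + 1)‖ ≤ r ^ (n + 1) * ‖W 0‖ + ((n : ℝ) + 1) * r ^ n * ‖g 0‖ := by
    intro n
    induction n with
    | zero =>
      have e : W (0 + 1) = σ₁ * W 0 + g 0 := by simp only [hg]; ring
      rw [e]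
      simp only [zero_add, pow_one, pow_zero, Nat.cast_zero, one_mul, mul_one]
      calc ‖σ₁ * W 0 + g 0‖ ≤ ‖σ₁ * W 0‖ + ‖g 0‖ := norm_add_le _ _
        _ = ‖σ₁‖ * ‖W 0‖ + ‖g 0‖ := by rw [norm_mul]
        _ ≤ r * ‖W 0‖ + ‖g 0‖ := by
          have : ‖σ₁‖ ≤ r := le_max_left _ _
          have h0 : 0 ≤ ‖W 0‖ := norm_nonneg _
          nlinarith
    | succ n ih =>
      have e : W (n + 1 + 1) = σ₁ * W (n + 1) + g (n + 1) := by simp only [hg]; ring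
      rw [e]
      have hgnorm : ‖g (n + 1)‖ ≤ r ^ (n + 1) * ‖g 0‖ := by
        rw [hgn (n + 1), norm_mul, norm_pow]
        exact mul_le_mul_of_nonneg_right (pow_le_pow_left₀ (norm_nonneg _) (le_max_right _ _) _)
          (norm_nonneg _)
      calc ‖σ₁ * W (n + 1) + g (n + 1)‖ ≤ ‖σ₁‖ * ‖W (n + 1)‖ + ‖g (n + 1)‖ := by
            rw [← norm_mul]; exact norm_add_le _ _
        _ ≤ r * (r ^ (n + 1) * ‖W 0‖ + (n + 1) * r ^ n * ‖g 0‖) + r ^ (n + 1) * ‖g 0‖ := by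
            have h1 : ‖σ₁‖ ≤ r := le_max_left _ _
            have h2 : 0 ≤ ‖W (n + 1)‖ := norm_nonneg _
            nlinarith [norm_nonneg σ₁]
        _ = r ^ (n + 1 + 1) * ‖W 0‖ + ((n + 1 : ℕ) + 1 : ℝ) * r ^ (n + 1) * ‖g 0‖ := by
            push_cast; ring
  have hlim : Tendsto (fun n : ℕ => r ^ (n + 1) * ‖W 0‖ + ((n : ℝ) + 1) * r ^ n * ‖g 0‖) atTop (𝓝 0) := by
    have h1 : Tendsto (fun n : ℕ => r ^ (n + 1)) atTop (𝓝 0) :=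
      (tendsto_pow_atTop_nhds_zero_of_lt_one hr0 hr1).comp (tendsto_add_atTop_nat 1)
    have h2 : Tendsto (fun n : ℕ => (n : ℝ) * r ^ n) atTop (𝓝 0) :=
      tendsto_self_mul_const_pow_of_lt_one hr0 hr1
    have h3 : Tendsto (fun n : ℕ => r ^ n) atTop (𝓝 0) := tendsto_pow_atTop_nhds_zero_of_lt_one hr0 hr1
    have h := (h1.mul_const ‖W 0‖).add (((h2.add h3)).mul_const ‖g 0‖)
    simp only [zero_mul, zero_add] at h
    refine h.congr fun n => ?_
    ring
  have hW1 : Tendsto (fun n => w (n + 1)) atTop (𝓝 0) := by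
    refine squeeze_zero_norm (fun n => ?_) hlim
    have : ‖w (n + 1)‖ = ‖W (n + 1)‖ := by simp only [hW, Complex.norm_real]
    rw [this]
    exact hbound n
  exact (tendsto_add_atTop_iff_nat 1).1 hW1

/-- ★ **Uniform Binet for `t³ = y t + y`.** If `0 < y`, `0 < μ`, `μ³ = yμ + y` and `u_{n+3} = y u_{n+1} + y u_n` (`u` real),
then `u_n / μⁿ → (u_2 + μ u_1 + (μ² − y) u_0)/(3μ² − y)` (`3μ² − y = p′(μ)` for `p(t) = t³ − yt − y`; `μ` is the unique positive
root, the other two roots have modulus `< μ` for EVERY `y > 0` — complex for `y < 27/4`, real for `y ≥ 27/4`).  Proof: with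
`v_n = u_n/μⁿ` and `κ = y/μ³ = 1/(1 + μ) ∈ (0,1)`, `v_{n+2} + v_{n+1} + κ v_n` is constant and `v_n −` (its mean) obeys
`tendsto_zero_of_rec_two`. [cite: Stanley2012EC1, §4.1 (Theorem 4.1.1 (iii))] -/
theorem tendsto_div_pow_of_cubic_rec {y μ : ℝ} (hy : 0 < y) (hμ : 0 < μ) (hc : μ ^ 3 = y * μ + y)
    (u : ℕ → ℝ) (hu : ∀ n, u (n + 3) = y * u (n + 1) + y * u n) :
    Tendsto (fun n => u n / μ ^ n) atTop
      (𝓝 ((u 2 + μ * u 1 + (μ ^ 2 - y) * u 0) / (3 * μ ^ 2 - y))) := by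
  have hμ0 : μ ≠ 0 := hμ.ne'
  set κ : ℝ := y / μ ^ 3 with hκ
  have hκ' : κ = 1 / (μ + 1) := by
    rw [hκ, hc, div_eq_div_iff (by positivity) (by positivity)]; ring
  have hκ0 : 0 < κ := by rw [hκ]; positivity
  have hκ1 : κ < 1 := by rw [hκ', div_lt_one (by positivity)]; linarith
  have h1κ : 1 - κ = y / μ ^ 2 := by
    rw [hκ, eq_div_iff (by positivity), sub_mul, div_mul_eq_mul_div, pow_succ]
    field_simp
    linear_combination hc
  set v : ℕ → ℝ := fun n => u n / μ ^ n with hv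
  have hv3 : ∀ n, v (n + 3) = (1 - κ) * v (n + 1) + κ * v n := by
    intro n
    simp only [hv]
    have hμn : μ ^ (n + 3) ≠ 0 := pow_ne_zero _ hμ0
    rw [div_eq_iff hμn, hu n, add_mul]
    have e1 : (1 - κ) * (u (n + 1) / μ ^ (n + 1)) * μ ^ (n + 3) = y * u (n + 1) := by
      rw [h1κ]; field_simp; ring
    have e2 : κ * (u n / μ ^ n) * μ ^ (n + 3) = y * u n := by
      rw [hκ]; field_simp; ring
    rw [e1, e2]
  have hz : ∀ n, v (n + 2) + v (n + 1) + κ * v n = v 2 + v 1 + κ * v 0 := by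
    intro n
    induction n with
    | zero => rfl
    | succ n ih =>
      rw [← ih, show n + 1 + 2 = n + 3 by omega, show n + 1 + 1 = n + 2 by omega, hv3 n]
      ring
  set L : ℝ := (v 2 + v 1 + κ * v 0) / (2 + κ) with hL
  have h2κ : (2 : ℝ) + κ ≠ 0 := by positivity
  have hL' : (2 + κ) * L = v 2 + v 1 + κ * v 0 := by rw [hL, mul_div_cancel₀ _ h2κ]
  have hw : ∀ n, (v (n + 2) - L) = -(v (n + 1) - L) - κ * (v n - L) := by
    intro n
    linear_combination (hz n) - hL'
  have hlim := tendsto_zero_of_rec_two hκ0 hκ1 (w := fun n => v n - L) hw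
  have hvlim : Tendsto v atTop (𝓝 L) := by
    have := hlim.add_const L
    simpa using this
  have hk1 : κ * μ ^ 2 = μ ^ 2 - y := by
    rw [hκ, div_mul_eq_mul_div, div_eq_iff (pow_ne_zero 3 hμ0)]
    linear_combination (-(μ ^ 2)) * hc
  have hLeq : L = (u 2 + μ * u 1 + (μ ^ 2 - y) * u 0) / (3 * μ ^ 2 - y) := by
    have hD : 3 * μ ^ 2 - y ≠ 0 := by
      have : y < μ ^ 2 := by nlinarith
      linarith
    rw [hL, div_eq_div_iff h2κ hD]
    have e : v 2 + v 1 + κ * v 0 = (u 2 + μ * u 1 + (μ ^ 2 - y) * u 0) / μ ^ 2 := by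
      rw [← hk1]
      simp only [hv, pow_zero, div_one, pow_one]
      field_simp
    rw [e, div_mul_eq_mul_div, div_eq_iff (pow_ne_zero 2 hμ0)]
    linear_combination (-(u 2 + μ * u 1 + (μ ^ 2 - y) * u 0)) * hk1
  rw [← hLeq]
  exact hvlim

end cubic

section quasipoly

/-! ## §B2 The double pole `(1 − y²X⁴)²`: `e_{N+8} = 2y² e_{N+4} − y⁴ e_N` gives `e_N = O(N · y^{N/2}) = o(μ^N)` -/

/-- A sequence all of whose subsequences along the residue classes mod `4` tend to `0` tends to `0`.
[cite: Stanley2012EC1, §4.1 (Theorem 4.1.1 (iii): quasi-polynomial parts)] -/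
private theorem tendsto_zero_of_mod_four {g : ℕ → ℝ} (h : ∀ c, Tendsto (fun k => g (4 * k + c)) atTop (𝓝 0)) :
    Tendsto g atTop (𝓝 0) := by
  have hS : Tendsto (fun k => ∑ c ∈ Finset.range 4, |g (4 * k + c)|) atTop (𝓝 0) := by
    have := tendsto_finsetSum (Finset.range 4) fun c _ => (h c).abs
    simpa using this
  have hdiv : Tendsto (fun n : ℕ => n / 4) atTop atTop :=
    Filter.tendsto_atTop_atTop.2 fun b => ⟨4 * b, fun n hn => (Nat.le_div_iff_mul_le (by norm_num)).2 (by omega)⟩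
  refine squeeze_zero_norm (fun n => ?_) (hS.comp hdiv)
  have hn : g n = g (4 * (n / 4) + n % 4) := by rw [Nat.div_add_mod]
  rw [Real.norm_eq_abs, hn]
  exact Finset.single_le_sum (f := fun c => |g (4 * (n / 4) + c)|) (fun c _ => abs_nonneg _)
    (Finset.mem_range.2 (Nat.mod_lt n (by norm_num)))

/-- The coefficients of `V(X)/(1 − y²X⁴)²` are negligible against `μ^N` when `y < μ²`: every real solution of
`e_{N+8} = 2y² e_{N+4} − y⁴ e_N` satisfies `e_N/μ^N → 0` (explicitly `e_{4k+c} = y^{2k} e_c + k y^{2k−2}(e_{c+4} − y² e_c)`).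
[cite: Stanley2012EC1, §4.1 (Theorem 4.1.1 (iii))] -/
theorem tendsto_div_pow_zero_of_rec_eight {y μ : ℝ} (hy : 0 < y) (hμ : 0 < μ) (hyμ : y < μ ^ 2) {e : ℕ → ℝ}
    (he : ∀ N, e (N + 8) = 2 * y ^ 2 * e (N + 4) - y ^ 4 * e N) :
    Tendsto (fun N => e N / μ ^ N) atTop (𝓝 0) := by
  set f : ℕ → ℝ := fun N => e (N + 4) - y ^ 2 * e N with hf
  have hfrec : ∀ N, f (N + 4) = y ^ 2 * f N := by
    intro N
    simp only [hf]
    rw [show N + 4 + 4 = N + 8 by omega, he N]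
    ring
  have hfk : ∀ c k, f (4 * k + c) = (y ^ 2) ^ k * f c := by
    intro c k
    induction k with
    | zero => simp
    | succ k ih => rw [show 4 * (k + 1) + c = 4 * k + c + 4 by ring, hfrec, ih]; ring
  have hek : ∀ c k, e (4 * (k + 1) + c) = (y ^ 2) ^ (k + 1) * e c + (k + 1) * (y ^ 2) ^ k * f c := by
    intro c k
    induction k with
    | zero =>
      simp only [zero_add, mul_one, pow_one, pow_zero, Nat.cast_zero, hf]
      rw [show 4 * 1 + c = c + 4 by ring]
      ring
    | succ k ih =>
      have e1 : e (4 * (k + 1 + 1) + c) = y ^ 2 * e (4 * (k + 1) + c) + f (4 * (k + 1) + c) := by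
        simp only [hf]
        rw [show 4 * (k + 1 + 1) + c = 4 * (k + 1) + c + 4 by ring]
        ring
      rw [e1, ih, hfk]
      push_cast
      ring
  set ρ : ℝ := y ^ 2 / μ ^ 4 with hρ
  have hρ0 : 0 ≤ ρ := by positivity
  have hρ1 : ρ < 1 := by
    rw [hρ, div_lt_one (by positivity)]
    have : y ^ 2 < (μ ^ 2) ^ 2 := pow_lt_pow_left₀ hyμ hy.le two_ne_zero
    nlinarith
  have hμ0 : μ ≠ 0 := hμ.ne'
  refine tendsto_zero_of_mod_four fun c => ?_
  refine (tendsto_add_atTop_iff_nat 1).1 ?_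
  have h1 : Tendsto (fun k : ℕ => ρ ^ (k + 1)) atTop (𝓝 0) :=
    (tendsto_pow_atTop_nhds_zero_of_lt_one hρ0 hρ1).comp (tendsto_add_atTop_nat 1)
  have h2 : Tendsto (fun k : ℕ => (k : ℝ) * ρ ^ k) atTop (𝓝 0) := tendsto_self_mul_const_pow_of_lt_one hρ0 hρ1
  have h3 : Tendsto (fun k : ℕ => ρ ^ k) atTop (𝓝 0) := tendsto_pow_atTop_nhds_zero_of_lt_one hρ0 hρ1
  have h := (h1.mul_const (e c / μ ^ c)).add ((h2.add h3).mul_const (f c / (μ ^ 4 * μ ^ c)))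
  simp only [zero_mul, zero_add] at h
  refine h.congr fun k => ?_
  have hμc : μ ^ (4 * (k + 1) + c) = (μ ^ 4) ^ (k + 1) * μ ^ c := by rw [pow_add, pow_mul]
  rw [hek c k, hρ, hμc, div_pow, div_pow, pow_succ, pow_succ, pow_succ]
  field_simp
  ring

end quasipoly

section coefficients

/-! ## §B3 Coefficient recurrences of `U(X)/(1 − yX² − yX³)` and `V(X)/(1 − y²X⁴)²` -/

variable {y : ℝ}

/-- If `φ · (1 − yX² − yX³)` is a polynomial of degree `≤ 2`, the coefficients of `φ` obey `u_{N+3} = y u_{N+1} + y u_N`.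
[cite: Stanley2012EC1, §4.1 (Theorem 4.1.1 (i) ⟺ (ii))] -/
private theorem coeff_rec_three {φ : ℝ⟦X⟧} {a b c : ℝ}
    (h : φ * (1 - C y * X ^ 2 - C y * X ^ 3) = C a + C b * X + C c * X ^ 2) (N : ℕ) :
    coeff (N + 3) φ = y * coeff (N + 1) φ + y * coeff N φ := by
  have h' : φ = C a + C b * X + C c * X ^ 2 + C y * (φ * X ^ 2) + C y * (φ * X ^ 3) := by
    linear_combination h
  have e2 : coeff (N + 3) (φ * X ^ 2) = coeff (N + 1) φ := by
    rw [show N + 3 = N + 1 + 2 by ring, PowerSeries.coeff_mul_X_pow]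
  have e3 : coeff (N + 3) (φ * X ^ 3) = coeff N φ := PowerSeries.coeff_mul_X_pow φ 3 N
  have := congrArg (coeff (N + 3)) h'
  simp only [map_add, PowerSeries.coeff_C_mul, e2, e3, PowerSeries.coeff_C, PowerSeries.coeff_X_pow, coeff_X,
    Nat.reduceEqDiff, if_false, mul_zero, zero_add] at this
  exact this

/-- … and its first three coefficients are `a`, `b`, `c + y a`. [cite: Stanley2012EC1, §4.1 (Theorem 4.1.1)] -/
private theorem coeff_init_three {φ : ℝ⟦X⟧} {a b c : ℝ}
    (h : φ * (1 - C y * X ^ 2 - C y * X ^ 3) = C a + C b * X + C c * X ^ 2) :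
    coeff 0 φ = a ∧ coeff 1 φ = b ∧ coeff 2 φ = c + y * a := by
  have h' : φ = C a + C b * X + C c * X ^ 2 + C y * (φ * X ^ 2) + C y * (φ * X ^ 3) := by
    linear_combination h
  have h0 := congrArg (coeff 0) h'
  have h1 := congrArg (coeff 1) h'
  have h2 := congrArg (coeff 2) h'
  simp only [map_add, PowerSeries.coeff_C_mul, PowerSeries.coeff_mul_X_pow', PowerSeries.coeff_C,
    coeff_X] at h0 h1 h2
  norm_num at h0 h1 h2
  exact ⟨by rw [PowerSeries.coeff_zero_eq_constantCoeff_apply]; exact h0, h1, by rw [h2, h0]⟩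

/-- If `φ · (1 − y²X⁴)²` is a polynomial of degree `≤ 7`, the coefficients of `φ` obey `e_{N+8} = 2y² e_{N+4} − y⁴ e_N`.
[cite: Stanley2012EC1, §4.1 (Theorem 4.1.1 (i) ⟺ (ii))] -/
private theorem coeff_rec_eight {φ : ℝ⟦X⟧} {v₀ v₁ v₂ v₃ v₄ v₅ v₆ v₇ : ℝ}
    (h : φ * (1 - C y * C y * X ^ 4) ^ 2 = C v₀ + C v₁ * X + C v₂ * X ^ 2 + C v₃ * X ^ 3 + C v₄ * X ^ 4
      + C v₅ * X ^ 5 + C v₆ * X ^ 6 + C v₇ * X ^ 7) (N : ℕ) :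
    coeff (N + 8) φ = 2 * y ^ 2 * coeff (N + 4) φ - y ^ 4 * coeff N φ := by
  have h' : φ = C v₀ + C v₁ * X + C v₂ * X ^ 2 + C v₃ * X ^ 3 + C v₄ * X ^ 4 + C v₅ * X ^ 5 + C v₆ * X ^ 6
      + C v₇ * X ^ 7 + C (2 * y ^ 2) * (φ * X ^ 4) - C (y ^ 4) * (φ * X ^ 8) := by
    simp only [map_mul, map_pow, map_ofNat]
    linear_combination h
  have e4 : coeff (N + 8) (φ * X ^ 4) = coeff (N + 4) φ := by
    rw [show N + 8 = N + 4 + 4 by ring, PowerSeries.coeff_mul_X_pow]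
  have e8 : coeff (N + 8) (φ * X ^ 8) = coeff N φ := PowerSeries.coeff_mul_X_pow φ 8 N
  have := congrArg (coeff (N + 8)) h'
  simp only [map_add, map_sub, PowerSeries.coeff_C_mul, e4, e8, PowerSeries.coeff_C, PowerSeries.coeff_X_pow, coeff_X,
    Nat.reduceEqDiff, if_false, mul_zero, zero_add] at this
  exact this

end coefficients

section amplitude

/-! ## §B4 The amplitude of `C_{1,N}(y,y)` -/

variable {y : ℝ}

/-- ★★★ **The amplitude of the one-cell honeycomb strip with two equal attractive walls**: for every `y > 0`,
`C_{1,N}(y,y) / μ_1(y,y)^N → A(y) = [U₂(y) + U₁(y)μ + U₀(y)μ²] / ((1 + 4y)²(3μ² − y))`, `μ = μ_1(y,y)` (`μ³ = yμ + y`), with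
`U₀ = 4 + 92y + 196y² + 144y³`, `U₁ = 4 + 32y + 220y² + 336y³`, `U₂ = 24y + 72y² + 192y³` — `γ = 1` with an explicit
amplitude for the whole one-parameter family (at `y = 1`: `(288 + 592μ + 436μ²)/(25(3μ² − 1))`, the plain-walk amplitude of
`HexSAWBrickWallStripWidthOneAmplitude.lean`).  From the landed rational series (`stripZ₂_one_self_series`): the numerator
`P(x;y,y)` is divisible by `1 − yx² + yx³`, and over `ℚ(y)` one has the partial-fraction decomposition
`(1+4y)² · P̃ = E·(1−yx²−yx³)(1−y²x⁴)² + U·(1−y²x⁴)² + V·(1−yx²−yx³)` with `U = U₀ + U₁x + U₂x²`, `deg E = 1`, `deg V = 7`;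
then `tendsto_div_pow_of_cubic_rec` and `tendsto_div_pow_zero_of_rec_eight`.
[cite: BeatonBousquetMelouDeGierDuminilCopinGuttmann2014, §3.2 (arXiv v5 p. 10: C_{T,N}(y,z); p. 12: the strip series are rational); MadrasSlade1993, §1.1 eq. (1.1.4) p. 5 (the amplitude A), §8.5 Notes pp. 278–279 (γ(R) = 1: Klein 1980, Alm–Janson 1990); AlmJanson1990; Stanley2012EC1, §4.1 (Theorem 4.1.1 (iii))] -/
theorem tendsto_stripZ₂_one_self_div_pow (hy : 0 < y) :
    Tendsto (fun N => stripZ₂ 1 N y y / stripMuY₂ 1 y y ^ N) atTop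
      (𝓝 (((24 * y + 72 * y ^ 2 + 192 * y ^ 3) + (4 + 32 * y + 220 * y ^ 2 + 336 * y ^ 3) * stripMuY₂ 1 y y
          + (4 + 92 * y + 196 * y ^ 2 + 144 * y ^ 3) * stripMuY₂ 1 y y ^ 2)
        / ((1 + 4 * y) ^ 2 * (3 * stripMuY₂ 1 y y ^ 2 - y)))) := by
  set μ := stripMuY₂ 1 y y with hμdef
  have hμ : 0 < μ := stripMuY₂_pos 1 hy hy
  have hc : μ ^ 3 = y * μ + y := stripMuY₂_one_self_pow_three_eq hy
  have hyμ : y < μ ^ 2 := lt_stripMuY₂_one_self_sq hy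
  have hμ0 : μ ≠ 0 := hμ.ne'
  -- (1) the reduced numerator: `P(X;y,y) = P̃ · (1 − yX² + yX³)`, hence `(Σ C_{1,N} X^N)·(1−yX²−yX³)(1−y²X⁴)² = P̃`
  set A : ℝ⟦X⟧ := PowerSeries.mk (fun N => stripZ₂ 1 N y y) with hA
  set T : ℝ⟦X⟧ := 1 - C y * X ^ 2 - C y * X ^ 3 with hT
  set Tm : ℝ⟦X⟧ := 1 - C y * X ^ 2 + C y * X ^ 3 with hTm
  set Q2 : ℝ⟦X⟧ := (1 - C y * C y * X ^ 4) ^ 2 with hQ2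
  set Pt : ℝ⟦X⟧ := C (2 + 2 * y) + C (2 + 8 * y) * X + C (10 * y + 2 * y ^ 2) * X ^ 2 + C (4 * y + 6 * y ^ 2) * X ^ 3
      + C (2 * y + 4 * y ^ 2 - 4 * y ^ 3) * X ^ 4 + C (8 * y ^ 2 - 12 * y ^ 3) * X ^ 5 + C (-8 * y ^ 3 - 4 * y ^ 4) * X ^ 6
      + C (-4 * y ^ 3 - 8 * y ^ 4) * X ^ 7 + C (-2 * y ^ 4 + 2 * y ^ 5) * X ^ 8 + C (2 * y ^ 4 + 4 * y ^ 5) * X ^ 9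
      + C (-2 * y ^ 5 + 2 * y ^ 6) * X ^ 10 + C (2 * y ^ 6) * X ^ 11 + C (2 * y ^ 5) * X ^ 12 with hPt
  have hS : A * (T * Tm * Q2) = twoWallP y y := stripZ₂_one_self_series y
  have hP : twoWallP y y = Pt * Tm := by
    simp only [twoWallP, hPt, hTm, map_add, map_sub, map_mul, map_pow, map_neg, map_ofNat]
    ring
  have hTm0 : Tm ≠ 0 := by
    intro h0
    have := congrArg constantCoeff h0
    simp [hTm] at this
  have h3 : A * (T * Q2) = Pt := by
    apply mul_right_cancel₀ hTm0
    rw [← hP, ← hS]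
    ring
  -- (2) partial fractions over `ℚ(y)`: `(1+4y)² P̃ = E·T·Q² + U·Q² + V·T`
  set d : ℝ := (1 + 4 * y) ^ 2 with hd
  set E : ℝ⟦X⟧ := C (2 + 14 * y + 16 * y ^ 2 - 32 * y ^ 3) + C (-2 - 16 * y - 32 * y ^ 2) * X with hE
  set U : ℝ⟦X⟧ := C (4 + 92 * y + 196 * y ^ 2 + 144 * y ^ 3) + C (4 + 32 * y + 220 * y ^ 2 + 336 * y ^ 3) * X
      + C (24 * y + 72 * y ^ 2 + 192 * y ^ 3) * X ^ 2 with hU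
  set V : ℝ⟦X⟧ := C (-4 - 88 * y - 164 * y ^ 2 - 80 * y ^ 3) + C (8 * y - 92 * y ^ 2 - 208 * y ^ 3) * X
      + C (-16 * y - 64 * y ^ 2 - 164 * y ^ 3 - 80 * y ^ 4) * X ^ 2 + C (-44 * y ^ 2 - 160 * y ^ 3 - 224 * y ^ 4) * X ^ 3
      + C (8 * y ^ 2 + 84 * y ^ 3 + 84 * y ^ 4 + 80 * y ^ 5) * X ^ 4
      + C (-4 * y ^ 2 - 24 * y ^ 3 + 84 * y ^ 4 + 176 * y ^ 5) * X ^ 5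
      + C (-28 * y ^ 4 + 52 * y ^ 5 + 80 * y ^ 6) * X ^ 6 + C (24 * y ^ 4 + 72 * y ^ 5 + 192 * y ^ 6) * X ^ 7 with hV
  have hPF : C d * Pt = E * (T * Q2) + U * Q2 + V * T := by
    simp only [hd, hPt, hE, hU, hV, hT, hQ2, map_add, map_sub, map_mul, map_pow, map_neg, map_ofNat, map_one]
    ring
  -- (3) inverses and the decomposition of the series: `(1+4y)² Σ C_{1,N} X^N = E + U/T + V/Q²`
  set iT : ℝ⟦X⟧ := PowerSeries.invOfUnit T 1 with hiT
  set iQ : ℝ⟦X⟧ := PowerSeries.invOfUnit Q2 1 with hiQ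
  have hTinv : T * iT = 1 := PowerSeries.mul_invOfUnit T 1 (by simp [hT])
  have hQinv : Q2 * iQ = 1 := PowerSeries.mul_invOfUnit Q2 1 (by simp [hQ2])
  have hdec : C d * A = E + U * iT + V * iQ := by
    linear_combination (-(C d) * A * Q2 * iQ + E * Q2 * iQ + V * iQ) * hTinv + (-(C d) * A + E + U * iT) * hQinv
      + (C d * iT * iQ) * h3 + (iT * iQ) * hPF
  -- (4) the two coefficient sequences and their recurrences
  set u : ℕ → ℝ := fun N => coeff N (U * iT) with hu
  set e : ℕ → ℝ := fun N => coeff N (V * iQ) with he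
  have hUiT : U * iT * (1 - C y * X ^ 2 - C y * X ^ 3) = C (4 + 92 * y + 196 * y ^ 2 + 144 * y ^ 3)
      + C (4 + 32 * y + 220 * y ^ 2 + 336 * y ^ 3) * X + C (24 * y + 72 * y ^ 2 + 192 * y ^ 3) * X ^ 2 := by
    rw [← hT, mul_assoc, mul_comm iT T, hTinv, mul_one]
  have hurec : ∀ N, u (N + 3) = y * u (N + 1) + y * u N := fun N => coeff_rec_three hUiT N
  obtain ⟨hu0, hu1, hu2⟩ := coeff_init_three hUiT
  have hViQ : V * iQ * (1 - C y * C y * X ^ 4) ^ 2 = C (-4 - 88 * y - 164 * y ^ 2 - 80 * y ^ 3)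
      + C (8 * y - 92 * y ^ 2 - 208 * y ^ 3) * X + C (-16 * y - 64 * y ^ 2 - 164 * y ^ 3 - 80 * y ^ 4) * X ^ 2
      + C (-44 * y ^ 2 - 160 * y ^ 3 - 224 * y ^ 4) * X ^ 3 + C (8 * y ^ 2 + 84 * y ^ 3 + 84 * y ^ 4 + 80 * y ^ 5) * X ^ 4
      + C (-4 * y ^ 2 - 24 * y ^ 3 + 84 * y ^ 4 + 176 * y ^ 5) * X ^ 5
      + C (-28 * y ^ 4 + 52 * y ^ 5 + 80 * y ^ 6) * X ^ 6 + C (24 * y ^ 4 + 72 * y ^ 5 + 192 * y ^ 6) * X ^ 7 := by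
    rw [← hQ2, mul_assoc, mul_comm iQ Q2, hQinv, mul_one]
  have herec : ∀ N, e (N + 8) = 2 * y ^ 2 * e (N + 4) - y ^ 4 * e N := fun N => coeff_rec_eight hViQ N
  -- (5) coefficient extraction: `(1+4y)² C_{1,N+2}(y,y) = u_{N+2} + e_{N+2}`
  have hcoef : ∀ N, d * stripZ₂ 1 (N + 2) y y = u (N + 2) + e (N + 2) := by
    intro N
    have := congrArg (coeff (N + 2)) hdec
    simp only [hA, hE, map_add, PowerSeries.coeff_C_mul, coeff_mk, PowerSeries.coeff_C, coeff_X, Nat.reduceEqDiff,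
      if_false, mul_zero, zero_add] at this
    simpa only [hu, he] using this
  -- (6) limits
  have hu0' : u 0 = 4 + 92 * y + 196 * y ^ 2 + 144 * y ^ 3 := hu0
  have hu1' : u 1 = 4 + 32 * y + 220 * y ^ 2 + 336 * y ^ 3 := hu1
  have hu2' : u 2 = 24 * y + 72 * y ^ 2 + 192 * y ^ 3 + y * (4 + 92 * y + 196 * y ^ 2 + 144 * y ^ 3) := hu2
  have hulim := tendsto_div_pow_of_cubic_rec hy hμ hc u hurec
  rw [hu0', hu1', hu2'] at hulim
  have helim := tendsto_div_pow_zero_of_rec_eight hy hμ hyμ herec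
  have hd0 : 0 < d := by positivity
  have hlim := ((hulim.add helim).div_const d)
  rw [add_zero] at hlim
  have key : Tendsto (fun N => stripZ₂ 1 N y y / μ ^ N) atTop
      (𝓝 ((24 * y + 72 * y ^ 2 + 192 * y ^ 3 + y * (4 + 92 * y + 196 * y ^ 2 + 144 * y ^ 3)
        + μ * (4 + 32 * y + 220 * y ^ 2 + 336 * y ^ 3) + (μ ^ 2 - y) * (4 + 92 * y + 196 * y ^ 2 + 144 * y ^ 3))
        / (3 * μ ^ 2 - y) / d)) := by
    refine hlim.congr' ?_
    filter_upwards [eventually_ge_atTop 2] with N hN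
    obtain ⟨M, rfl⟩ : ∃ M, N = M + 2 := ⟨N - 2, by omega⟩
    rw [← add_div, ← hcoef M, div_div, mul_comm (μ ^ (M + 2)) d, ← div_div, mul_div_cancel_left₀ _ hd0.ne']
  have hlimeq : (24 * y + 72 * y ^ 2 + 192 * y ^ 3 + y * (4 + 92 * y + 196 * y ^ 2 + 144 * y ^ 3)
        + μ * (4 + 32 * y + 220 * y ^ 2 + 336 * y ^ 3) + (μ ^ 2 - y) * (4 + 92 * y + 196 * y ^ 2 + 144 * y ^ 3))
        / (3 * μ ^ 2 - y) / d
      = (24 * y + 72 * y ^ 2 + 192 * y ^ 3 + (4 + 32 * y + 220 * y ^ 2 + 336 * y ^ 3) * μ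
        + (4 + 92 * y + 196 * y ^ 2 + 144 * y ^ 3) * μ ^ 2) / (d * (3 * μ ^ 2 - y)) := by
    rw [div_div]
    ring
  rw [hlimeq] at key
  exact key

/-- `A(y) > 0`. [cite: MadrasSlade1993, §1.1 eq. (1.1.4) p. 5 (the amplitude A is a positive constant)] -/
theorem stripZ₂_one_self_amplitude_pos (hy : 0 < y) :
    0 < (((24 * y + 72 * y ^ 2 + 192 * y ^ 3) + (4 + 32 * y + 220 * y ^ 2 + 336 * y ^ 3) * stripMuY₂ 1 y y
          + (4 + 92 * y + 196 * y ^ 2 + 144 * y ^ 3) * stripMuY₂ 1 y y ^ 2)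
        / ((1 + 4 * y) ^ 2 * (3 * stripMuY₂ 1 y y ^ 2 - y))) := by
  have hμ : 0 < stripMuY₂ 1 y y := stripMuY₂_pos 1 hy hy
  have hyμ : y < stripMuY₂ 1 y y ^ 2 := lt_stripMuY₂_one_self_sq hy
  apply div_pos
  · positivity
  · apply mul_pos (by positivity)
    linarith

/-- ★★ **`C_{1,N}(y,y) ∼ A(y) · μ_1(y,y)^N`** for every `y > 0` (asymptotic equivalence `f ∼ g ⟺ f/g → 1`, here Mathlib's
`Asymptotics.IsEquivalent`): `γ = 1` with the explicit amplitude `A(y)` of `tendsto_stripZ₂_one_self_div_pow`.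
[cite: MadrasSlade1993, §1.1 eq. (1.1.4) p. 5 (c_N ∼ Aμ^N N^{γ−1}), §8.5 Notes pp. 278–279 (γ(R) = 1: Klein 1980, Alm–Janson 1990); BeatonBousquetMelouDeGierDuminilCopinGuttmann2014, §3.2 (arXiv v5 p. 10); AlmJanson1990] -/
theorem stripZ₂_one_self_isEquivalent (hy : 0 < y) :
    (fun N => stripZ₂ 1 N y y) ~[atTop] fun N =>
      (((24 * y + 72 * y ^ 2 + 192 * y ^ 3) + (4 + 32 * y + 220 * y ^ 2 + 336 * y ^ 3) * stripMuY₂ 1 y y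
          + (4 + 92 * y + 196 * y ^ 2 + 144 * y ^ 3) * stripMuY₂ 1 y y ^ 2)
        / ((1 + 4 * y) ^ 2 * (3 * stripMuY₂ 1 y y ^ 2 - y))) * stripMuY₂ 1 y y ^ N := by
  refine isEquivalent_of_tendsto_one ?_
  have hA := stripZ₂_one_self_amplitude_pos hy
  have h := (tendsto_stripZ₂_one_self_div_pow hy).div_const
    (((24 * y + 72 * y ^ 2 + 192 * y ^ 3) + (4 + 32 * y + 220 * y ^ 2 + 336 * y ^ 3) * stripMuY₂ 1 y y
          + (4 + 92 * y + 196 * y ^ 2 + 144 * y ^ 3) * stripMuY₂ 1 y y ^ 2)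
        / ((1 + 4 * y) ^ 2 * (3 * stripMuY₂ 1 y y ^ 2 - y)))
  rw [div_self hA.ne'] at h
  refine h.congr fun N => ?_
  simp only [Pi.div_apply]
  rw [div_div, mul_comm (stripMuY₂ 1 y y ^ N)]

/-- ★ **Ratio limit**: `C_{1,N+1}(y,y) / C_{1,N}(y,y) → μ_1(y,y)` for every `y > 0`.
[cite: BeatonBousquetMelouDeGierDuminilCopinGuttmann2014, §3.2 Proposition 6 (arXiv v5 p. 10: μ_T(y,z)); MadrasSlade1993, §8.5 Notes pp. 278–279 (γ(R) = 1)] -/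
theorem tendsto_stripZ₂_one_self_ratio (hy : 0 < y) :
    Tendsto (fun N => stripZ₂ 1 (N + 1) y y / stripZ₂ 1 N y y) atTop (𝓝 (stripMuY₂ 1 y y)) := by
  set μ := stripMuY₂ 1 y y with hμdef
  have hμ0 : 0 < μ := stripMuY₂_pos 1 hy hy
  have hA := stripZ₂_one_self_amplitude_pos hy
  have h0 := tendsto_stripZ₂_one_self_div_pow hy
  rw [← hμdef] at hA h0
  set L : ℝ := (((24 * y + 72 * y ^ 2 + 192 * y ^ 3) + (4 + 32 * y + 220 * y ^ 2 + 336 * y ^ 3) * μ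
    + (4 + 92 * y + 196 * y ^ 2 + 144 * y ^ 3) * μ ^ 2) / ((1 + 4 * y) ^ 2 * (3 * μ ^ 2 - y)) : ℝ) with hL
  have h1 : Tendsto (fun N => stripZ₂ 1 (N + 1) y y / μ ^ (N + 1)) atTop (𝓝 L) := h0.comp (tendsto_add_atTop_nat 1)
  have h := (h1.div h0 hA.ne').const_mul μ
  rw [div_self hA.ne', mul_one] at h
  refine h.congr' ?_
  have hev : ∀ᶠ N in atTop, stripZ₂ 1 N y y / μ ^ N ≠ 0 := h0.eventually_ne hA.ne'
  filter_upwards [hev] with N hN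
  have hμ0' : μ ≠ 0 := hμ0.ne'
  have hμN : μ ^ N ≠ 0 := pow_ne_zero _ hμ0'
  simp only [Pi.div_apply]
  rw [div_div_div_comm, pow_succ, mul_div_cancel_left₀ μ hμN, mul_div, mul_div_cancel_left₀ _ hμ0']


end amplitude

end WidthOneYZ

end Literature.Probability.RandomPlanarGeometry.SAW.HexBW
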